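import Summits.NavierStokesRegularity.FluidComputer.SublatticeSupport
import HarnessLib

/-!
# The dihedral sector of the `z`-mean plane: modes on the four mirror lines stay empty

HONEST FRAMING (cell `pub-fluidc`, verbatim): *low prior, high value-of-information experiment on Tao's
machine paradigm; NOT a claim that NS blows up.* Nothing here concerns the Navier–Stokes PDE beyond the
Galerkin-truncated ODE system both engines of the cell integrate.

Companion of `SublatticeSupport` (the OFF-plane half), typing the IN-plane "sharp form" of the gadget seat's
symmetry analysis of the pure-swirl Hou–Luo-type data (GADGETS gen 46, `code/gadgets/tests/houluo_floor_j092806.md`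
§1 F46-1, STATUS 2026-08-20T09:43Z). Besides the vertical period `T_λ`, those data are fixed by
`S = T_{λ/2} ∘ (z ↦ -z)`, `G = T_{λ/2} ∘ (x ↦ -x)` and the quarter turn `R90` about the vertical axis (all exact
on the `2π`-periodic box: as Fourier actions `reflZ.sg (vertical a)`, `reflX.sg (vertical a)`, `rotZ.act`). On
`z`-MEAN wavevectors (`k₂ = 0`) the half-period phase is `1`, and the printed argument goes: for `k` on a mirror
line of the dihedral group `D₄` the mirror-odd component of `û(k)` vanishes, incompressibility kills the component
along `k`, and `S` kills `û₂`; hence `û(k,t) = 0` on the four MIRROR LINES `k₀ k₁ (k₀² - k₁²) = 0` of the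
`z`-mean plane — in particular on every `z`-mean wavevector with `|k|² ≤ 4` — while `(±2,±1,0)`, `(±1,±2,0)`
(`|k|² = 5`, the `A₂` pseudoscalar `ψ = sin x sin y (cos x − cos y)`) are NOT forced to vanish. THIS FILE proves
exactly that, for a field fixed by the three operations (`coeff_eq_zero_of_mirror_line`) and, by persistence of
space-group symmetries (`Literature …/SpaceGroupSymmetry`), along every unforced Galerkin solution on a mask
mapped into itself by the three point operations whose datum is so fixed (`mirror_lines_empty`); with the vertical
period `2π/m`, `m ≥ 3`, and `SublatticeSupport.low_shell_offplane_empty` the joint corollary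
`low_modes_empty`: **every mode with `|k|² ≤ 4` is empty at all times**. What is NOT claimed: emptiness of the
rest of the `z`-mean plane (false on the box by the printed witness), anything about round-off.
0 sorry, 0 named facts (D-0026). [folklore]
-/

noncomputable section

namespace Summit.NavierStokesRegularity.FluidComputer.DihedralSector

open Literature.Analysis.FluidPDE.FluidComputer
open Literature.Analysis.FluidPDE.FluidComputer.ShellTransfer
open Complex

/-! ## Static part: a field fixed by `G`, `S`, `R90` -/

section Static

variable {A : FourierVelocity} {a : ℝ}

/-- On a `z`-mean wavevector the phase of a vertical translation is `1`. [folklore] -/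
theorem phase_vertical_of_zmean (a : ℝ) {k : Fin 3 → ℤ} (hk : k 2 = 0) : phase (vertical a) k = 1 := by
  refine phase_eq_one_of_even (n := 0) ?_ ⟨0, by norm_num⟩
  rw [rdot_vertical, hk]
  simp

/-- `G = T ∘ (x ↦ -x)` on a `z`-mean mode: `û_j(k) = Σ_l (M_X)_{jl} û_l(-k₀, k₁, k₂)`. [folklore] -/
theorem coeff_eq_of_G (hG : reflX.sg (vertical a) A = A) {k : Fin 3 → ℤ} (hk : k 2 = 0) (j : Fin 3) :
    A.coeff k j = ∑ l, ((reflX.M j l : ℤ) : ℂ) * A.coeff ![-k 0, k 1, k 2] l := by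
  have h := congrArg (fun B : FourierVelocity => B.coeff k j) hG
  rw [LatticeIsometry.sg_def, translate_coeff, phase_vertical_of_zmean a hk, one_mul,
    LatticeIsometry.act_coeff, reflX_invK] at h
  exact h.symm

/-- `S = T ∘ (z ↦ -z)` on a `z`-mean mode kills the vertical component: `û₂(k) = 0`. [folklore] -/
theorem coeff_two_eq_zero_of_S (hS : reflZ.sg (vertical a) A = A) {k : Fin 3 → ℤ} (hk : k 2 = 0) :
    A.coeff k 2 = 0 := by
  have h := congrArg (fun B : FourierVelocity => B.coeff k 2) hS
  rw [LatticeIsometry.sg_def, translate_coeff, phase_vertical_of_zmean a hk, one_mul,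
    LatticeIsometry.act_coeff, reflZ_invK] at h
  have e : (![k 0, k 1, -k 2] : Fin 3 → ℤ) = k := by
    funext i; fin_cases i <;> simp [hk]
  rw [e] at h
  unfold reflZ at h
  simp [Fin.sum_univ_three] at h
  -- h : -A.coeff k 2 = A.coeff k 2
  linear_combination -(h / 2)

/-- `R90` transports coefficients: `û_j(k) = Σ_l (M_R)_{jl} û_l(k₁, -k₀, k₂)`. [folklore] -/
theorem coeff_eq_of_R (hR : rotZ.act A = A) (k : Fin 3 → ℤ) (j : Fin 3) :
    A.coeff k j = ∑ l, ((rotZ.M j l : ℤ) : ℂ) * A.coeff ![k 1, -k 0, k 2] l := by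
  have h := congrArg (fun B : FourierVelocity => B.coeff k j) hR
  rw [LatticeIsometry.act_coeff, rotZ_invK] at h
  exact h.symm

/-- **The `k₁`-axis line (`k₀ = 0`, `k₁ ≠ 0`).** [folklore] -/
theorem coeff_eq_zero_of_axis0 (hG : reflX.sg (vertical a) A = A) (hS : reflZ.sg (vertical a) A = A)
    {k : Fin 3 → ℤ} (hk2 : k 2 = 0) (hk0 : k 0 = 0) (hk1 : k 1 ≠ 0) : A.coeff k = 0 := by
  have e : (![-k 0, k 1, k 2] : Fin 3 → ℤ) = k := by
    funext i; fin_cases i <;> simp [hk0]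
  -- mirror-odd component
  have h0 : A.coeff k 0 = 0 := by
    have h := coeff_eq_of_G hG hk2 0
    rw [e] at h
    unfold reflX at h
    simp [Fin.sum_univ_three] at h
    linear_combination h / 2
  -- vertical component
  have h2 : A.coeff k 2 = 0 := coeff_two_eq_zero_of_S hS hk2
  -- incompressibility kills the component along k
  have hd := A.divFree k
  rw [Fin.sum_univ_three, h0, h2, hk0] at hd
  have hk1C : ((k 1 : ℤ) : ℂ) ≠ 0 := by exact_mod_cast hk1
  have h1 : A.coeff k 1 = 0 := by
    have : ((k 1 : ℤ) : ℂ) * A.coeff k 1 = 0 := by simpa using hd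
    exact (mul_eq_zero.mp this).resolve_left hk1C
  funext j
  fin_cases j
  · exact h0
  · exact h1
  · exact h2

/-- **The zero mode** (fixed by the quarter turn and by `S`). [folklore] -/
theorem coeff_zero_eq_zero (hS : reflZ.sg (vertical a) A = A) (hR : rotZ.act A = A) : A.coeff 0 = 0 := by
  have e : (![(0 : Fin 3 → ℤ) 1, -(0 : Fin 3 → ℤ) 0, (0 : Fin 3 → ℤ) 2] : Fin 3 → ℤ) = 0 := by
    funext i; fin_cases i <;> simp
  have h0 := coeff_eq_of_R hR 0 0
  have h1 := coeff_eq_of_R hR 0 1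
  rw [e] at h0 h1
  unfold rotZ at h0 h1
  simp [Fin.sum_univ_three] at h0 h1
  -- h0 : A.coeff 0 0 = -A.coeff 0 1 ; h1 : A.coeff 0 1 = A.coeff 0 0
  have h2 : A.coeff 0 2 = 0 := coeff_two_eq_zero_of_S hS rfl
  funext j
  fin_cases j
  · show A.coeff 0 0 = 0
    linear_combination (h0 - h1) / 2
  · show A.coeff 0 1 = 0
    linear_combination (h0 + h1) / 2
  · exact h2

/-- **The `k₀`-axis line (`k₁ = 0`)**, transported from the other axis by the quarter turn. [folklore] -/
theorem coeff_eq_zero_of_axis1 (hG : reflX.sg (vertical a) A = A) (hS : reflZ.sg (vertical a) A = A)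
    (hR : rotZ.act A = A) {k : Fin 3 → ℤ} (hk2 : k 2 = 0) (hk1 : k 1 = 0) : A.coeff k = 0 := by
  by_cases hk0 : k 0 = 0
  · have : k = 0 := by funext i; fin_cases i <;> simp [hk0, hk1, hk2]
    rw [this]
    exact coeff_zero_eq_zero hS hR
  · have hz : A.coeff ![k 1, -k 0, k 2] = 0 :=
      coeff_eq_zero_of_axis0 hG hS (by simp [hk2]) (by simp [hk1]) (by simpa using hk0)
    funext j
    rw [coeff_eq_of_R hR k j, hz]
    simp

/-- **The diagonal `k₀ = k₁`.** [folklore] -/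
theorem coeff_eq_zero_of_diag (hG : reflX.sg (vertical a) A = A) (hS : reflZ.sg (vertical a) A = A)
    (hR : rotZ.act A = A) {k : Fin 3 → ℤ} (hk2 : k 2 = 0) (hd : k 0 = k 1) : A.coeff k = 0 := by
  by_cases hk0 : k 0 = 0
  · exact coeff_eq_zero_of_axis1 hG hS hR hk2 (hd ▸ hk0)
  · -- û(k) = M_X û(kX), û(kX) = M_R û(R⁻¹ kX) and R⁻¹ kX = k on the diagonal
    have e : (![(![-k 0, k 1, k 2] : Fin 3 → ℤ) 1, -(![-k 0, k 1, k 2] : Fin 3 → ℤ) 0,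
        (![-k 0, k 1, k 2] : Fin 3 → ℤ) 2] : Fin 3 → ℤ) = k := by
      funext i; fin_cases i <;> simp [hd]
    have hX0 := coeff_eq_of_G hG hk2 0
    have hX1 := coeff_eq_of_G hG hk2 1
    have hR0 := coeff_eq_of_R hR ![-k 0, k 1, k 2] 0
    have hR1 := coeff_eq_of_R hR ![-k 0, k 1, k 2] 1
    rw [e] at hR0 hR1
    unfold reflX at hX0 hX1
    unfold rotZ at hR0 hR1
    simp [Fin.sum_univ_three] at hX0 hX1 hR0 hR1
    -- hX0 : A k 0 = -A kX 0 ; hX1 : A k 1 = A kX 1 ; hR0 : A kX 0 = -A k 1 ; hR1 : A kX 1 = A k 0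
    have h01 : A.coeff k 0 = A.coeff k 1 := by rw [hX0, hR0]; ring
    have h2 : A.coeff k 2 = 0 := coeff_two_eq_zero_of_S hS hk2
    have hdiv := A.divFree k
    rw [Fin.sum_univ_three, h2, ← hd, ← h01] at hdiv
    have hk0C : ((k 0 : ℤ) : ℂ) ≠ 0 := by exact_mod_cast hk0
    have h0 : A.coeff k 0 = 0 := by
      have : (2 * ((k 0 : ℤ) : ℂ)) * A.coeff k 0 = 0 := by linear_combination hdiv
      rcases mul_eq_zero.mp this with h | h
      · exact absurd h (mul_ne_zero two_ne_zero hk0C)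
      · exact h
    funext j
    fin_cases j
    · exact h0
    · show A.coeff k 1 = 0
      rw [← h01, h0]
    · exact h2

/-- **The anti-diagonal `k₀ = -k₁`**, transported from the diagonal by `G`. [folklore] -/
theorem coeff_eq_zero_of_antidiag (hG : reflX.sg (vertical a) A = A) (hS : reflZ.sg (vertical a) A = A)
    (hR : rotZ.act A = A) {k : Fin 3 → ℤ} (hk2 : k 2 = 0) (hd : k 0 = -k 1) : A.coeff k = 0 := by
  have hz : A.coeff ![-k 0, k 1, k 2] = 0 :=
    coeff_eq_zero_of_diag hG hS hR (by simp [hk2]) (by simp [hd])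
  funext j
  rw [coeff_eq_of_G hG hk2 j, hz]
  simp

/-- **A field fixed by `G`, `S` and the quarter turn vanishes on the four mirror lines of the `z`-mean plane.**
[folklore] -/
theorem coeff_eq_zero_of_mirror_line (hG : reflX.sg (vertical a) A = A) (hS : reflZ.sg (vertical a) A = A)
    (hR : rotZ.act A = A) {k : Fin 3 → ℤ} (hk2 : k 2 = 0)
    (hline : k 0 = 0 ∨ k 1 = 0 ∨ k 0 = k 1 ∨ k 0 = -k 1) : A.coeff k = 0 := by
  rcases hline with h | h | h | h
  · by_cases h1 : k 1 = 0
    · exact coeff_eq_zero_of_axis1 hG hS hR hk2 h1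
    · exact coeff_eq_zero_of_axis0 hG hS hk2 h h1
  · exact coeff_eq_zero_of_axis1 hG hS hR hk2 h
  · exact coeff_eq_zero_of_diag hG hS hR hk2 h
  · exact coeff_eq_zero_of_antidiag hG hS hR hk2 h

/-- Every `z`-mean integer wavevector with `|k|² ≤ 4` lies on a mirror line. [folklore] -/
theorem mirror_line_of_low {k : Fin 3 → ℤ} (hk2 : k 2 = 0) (hlow : knormSq k ≤ 4) :
    k 0 = 0 ∨ k 1 = 0 ∨ k 0 = k 1 ∨ k 0 = -k 1 := by
  have h : (k 0) ^ 2 + (k 1) ^ 2 ≤ 4 := by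
    have hR : ((k 0 : ℤ) : ℝ) ^ 2 + ((k 1 : ℤ) : ℝ) ^ 2 ≤ 4 := by
      unfold knormSq at hlow
      rw [Fin.sum_univ_three, hk2] at hlow
      simpa using hlow
    exact_mod_cast hR
  have h0 : -2 ≤ k 0 ∧ k 0 ≤ 2 := by constructor <;> nlinarith [sq_nonneg (k 1), sq_nonneg (k 0 + 2), sq_nonneg (k 0 - 2)]
  have h1 : -2 ≤ k 1 ∧ k 1 ≤ 2 := by constructor <;> nlinarith [sq_nonneg (k 0), sq_nonneg (k 1 + 2), sq_nonneg (k 1 - 2)]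
  obtain ⟨h0a, h0b⟩ := h0
  obtain ⟨h1a, h1b⟩ := h1
  interval_cases hx : k 0 <;> interval_cases hy : k 1 <;> simp_all

end Static

/-! ## Along Galerkin solutions -/

/-- **THE MIRROR LINES STAY EMPTY.** Along every unforced Galerkin solution (any `ν`, any pressure multiplier)
supported in a mask `S` mapped into itself by the three point operations, whose datum at one time is fixed by
`G = T_a ∘ (x ↦ -x)`, `S = T_a ∘ (z ↦ -z)` (same vertical shift `a`) and the quarter turn: every `z`-mean mode
on a mirror line `k₀ k₁ (k₀² − k₁²) = 0` is empty at every time. [folklore] -/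
theorem mirror_lines_empty {U : ℝ → FourierVelocity} {S : Finset (Fin 3 → ℤ)} {ν : ℝ}
    {c : ℝ → (Fin 3 → ℤ) → ℂ} (hU : IsGalerkinSolution U S ν c fun _ _ _ => 0) (hs : IsSupportedOn U S)
    (hX : ∀ p ∈ S, reflX.invK p ∈ S) (hX' : ∀ p ∈ S, reflX.actK p ∈ S)
    (hZ : ∀ p ∈ S, reflZ.invK p ∈ S) (hZ' : ∀ p ∈ S, reflZ.actK p ∈ S)
    (hRi : ∀ p ∈ S, rotZ.invK p ∈ S) (hRa : ∀ p ∈ S, rotZ.actK p ∈ S)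
    {a : ℝ} {t₀ : ℝ} (hG : reflX.sg (vertical a) (U t₀) = U t₀) (hSz : reflZ.sg (vertical a) (U t₀) = U t₀)
    (hR : rotZ.act (U t₀) = U t₀) (t : ℝ) {k : Fin 3 → ℤ} (hk2 : k 2 = 0)
    (hline : k 0 = 0 ∨ k 1 = 0 ∨ k 0 = k 1 ∨ k 0 = -k 1) :
    (U t).coeff k = 0 ∧ modalEnergy (U t) k = 0 := by
  have hGt := reflX.sg_eq_self hU hs hX hX' (vertical a) hG t
  have hSt := reflZ.sg_eq_self hU hs hZ hZ' (vertical a) hSz t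
  have hRt := rotZ.act_eq_self hU hs hRi hRa hR t
  have h := coeff_eq_zero_of_mirror_line hGt hSt hRt hk2 hline
  exact ⟨h, modalEnergy_eq_zero_of_coeff _ h⟩

/-- **COROLLARY: EVERY MODE WITH `|k|² ≤ 4` IS EMPTY AT ALL TIMES** when, in addition, the datum is fixed by
the vertical translation by one period `2π/m` with `m ≥ 3` (the off-plane modes by `SublatticeSupport`, the
`z`-mean ones by the mirror lines). The first free modes are `(±2,±1,0)`, `(±1,±2,0)`. [folklore] -/
theorem low_modes_empty {U : ℝ → FourierVelocity} {S : Finset (Fin 3 → ℤ)} {ν : ℝ}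
    {c : ℝ → (Fin 3 → ℤ) → ℂ} (hU : IsGalerkinSolution U S ν c fun _ _ _ => 0) (hs : IsSupportedOn U S)
    (hX : ∀ p ∈ S, reflX.invK p ∈ S) (hX' : ∀ p ∈ S, reflX.actK p ∈ S)
    (hZ : ∀ p ∈ S, reflZ.invK p ∈ S) (hZ' : ∀ p ∈ S, reflZ.actK p ∈ S)
    (hRi : ∀ p ∈ S, rotZ.invK p ∈ S) (hRa : ∀ p ∈ S, rotZ.actK p ∈ S)
    {a : ℝ} {m : ℕ} (hm : 3 ≤ m) {t₀ : ℝ} (hG : reflX.sg (vertical a) (U t₀) = U t₀)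
    (hSz : reflZ.sg (vertical a) (U t₀) = U t₀) (hR : rotZ.act (U t₀) = U t₀)
    (hT : translate (vertical (2 * Real.pi / m)) (U t₀) = U t₀) (t : ℝ) {k : Fin 3 → ℤ}
    (hlow : knormSq k ≤ 4) : (U t).coeff k = 0 ∧ modalEnergy (U t) k = 0 := by
  by_cases hk2 : k 2 = 0
  · exact mirror_lines_empty hU hs hX hX' hZ hZ' hRi hRa hG hSz hR t hk2 (mirror_line_of_low hk2 hlow)
  · have hm0 : m ≠ 0 := by omega
    have hlt : knormSq k < (m : ℝ) ^ 2 := by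
      have h3 : (3 : ℝ) ≤ m := by exact_mod_cast hm
      nlinarith
    exact SublatticeSupport.low_shell_offplane_empty hU hs hm0 hT t hlt hk2

end Summit.NavierStokesRegularity.FluidComputer.DihedralSector

end
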